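import Mathlib.Analysis.Normed.Field.Basic
import Mathlib.Analysis.SpecialFunctions.Pow.Real
import Mathlib.Data.ZMod.Units
import HarnessLib

/-!
# The `2`-adic size of a Gauss sum of conductor `4` or `8`: `‖Σ_{a ∈ (ℤ/2ⁿ)ˣ} f(a)⁻¹ ζ^{−a}‖ = 2^{−n/2}`
# in any normed field with `‖2‖ = 1/2` (weakest sufficient, norm-only, phase-free form)

Topic `Literature/NumberTheory/LFunctions` (namespace = path; grouping sub-namespace `GaussSumTwoPower`).
The non-archimedean twin, at the two conductors `2ⁿ`, `n ∈ {2, 3}` that occur for the split prime `2` in an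
imaginary quadratic field, of the classical size of a primitive Gauss sum "`|τ(χ)| = √N`" (Bump, *Automorphic
forms and representations*, Ch. 1 eq. (1.5), p. 13) and of de Shalit's "`G(ε)·\overline{G(ε)} = p^{n(k−1)}`"
(II.4.11 Remark (i), p. 66) at `k = 0`: for a character `f` of `(ℤ/2ⁿ)ˣ` of EXACT level `n`
(`f(1 + 2ⁿ⁻¹) = −1`) and a primitive `2ⁿ`-th root of unity `ζ` (`ζ^{2^{n−1}} = −1`), the sum
`Σ_a f(a)⁻¹ ζ^{−a}` has norm `2^{−n/2}` — by direct evaluation (`−2ζ` at conductor 4, `−2ζ(ζ² ± 1)` at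
conductor 8). Pure Mathlib; PROVED; port of cell `bsd-print-cf2`'s stub-ideation k1-g40 §C (STUB-PLAN
`SplitBadTwoLowerHalfOfFacts` v7.6 row 123), consumed by the `p = 2` Kronecker-limit-formula value ledger.
A symbolic-`n` version (`|τ|² = 2ⁿ` by double counting) is NOT here.

References: [Bump1997] Ch. 1 §1 eq. (1.5) (p. 13); [deShalit1987] II.4.11 Remark (i) (p. 66).
-/

noncomputable section

namespace Literature.NumberTheory.LFunctions

namespace GaussSumTwoPower

variable {F : Type*} [NormedField F]

/-- `‖ζ‖ = 1` if `ζ^k = −1`, `k ≠ 0`. [folklore] -/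
private theorem norm_eq_one_of_pow_eq_neg_one {ζ : F} {k : ℕ} (hk : k ≠ 0) (hζ : ζ ^ k = -1) : ‖ζ‖ = 1 := by
  have h : ‖ζ‖ ^ k = 1 := by rw [← norm_pow, hζ, norm_neg, norm_one]
  exact (pow_eq_one_iff_of_nonneg (norm_nonneg ζ) hk).mp h

/-- `‖i + s‖ = 2^{-1/2}` for `i² = −1`, `s² = 1`, when `‖2‖ = 1/2`: `(i + s)² = 2 s i`. [folklore] -/
private theorem norm_sq_root_add_sign (h2 : ‖(2 : F)‖ = 2⁻¹) {i s : F} (hi : i ^ 2 = -1) (hs : s ^ 2 = 1) :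
    ‖i + s‖ = (2 : ℝ) ^ (-(1 : ℝ) / 2) := by
  have hs' : s = 1 ∨ s = -1 := sq_eq_one_iff.mp hs
  have hsq : (i + s) ^ 2 = 2 * s * i := by
    have : (i + s) ^ 2 = i ^ 2 + 2 * s * i + s ^ 2 := by ring
    rw [this, hi, hs]; ring
  have hni : ‖i‖ = 1 := norm_eq_one_of_pow_eq_neg_one two_ne_zero hi
  have hns : ‖s‖ = 1 := by rcases hs' with rfl | rfl <;> simp
  have hn2 : ‖i + s‖ ^ 2 = 2⁻¹ := by
    rw [← norm_pow, hsq, norm_mul, norm_mul, h2, hns, hni]; ring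
  have hpos : 0 ≤ ‖i + s‖ := norm_nonneg _
  have : ‖i + s‖ = Real.sqrt 2⁻¹ := by
    rw [← hn2, Real.sqrt_sq hpos]
  rw [this, Real.sqrt_eq_rpow, ← Real.rpow_neg_one 2, ← Real.rpow_mul (by norm_num : (0:ℝ) ≤ 2)]
  norm_num

/-- The unit `3 = 1 + 2 ∈ (ℤ/4)ˣ` (generator of `ker((ℤ/4)ˣ → (ℤ/2)ˣ)`). [folklore] -/
def u3 : (ZMod 4)ˣ := ⟨3, 3, by decide, by decide⟩
/-- The unit `3 ∈ (ℤ/8)ˣ`. [folklore] -/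
def w3 : (ZMod 8)ˣ := ⟨3, 3, by decide, by decide⟩
/-- The unit `5 = 1 + 4 ∈ (ℤ/8)ˣ` (generator of `ker((ℤ/8)ˣ → (ℤ/4)ˣ)`). [folklore] -/
def w5 : (ZMod 8)ˣ := ⟨5, 5, by decide, by decide⟩
/-- The unit `7 ∈ (ℤ/8)ˣ`. [folklore] -/
def w7 : (ZMod 8)ˣ := ⟨7, 7, by decide, by decide⟩

/-- `(ℤ/4)ˣ = {1, 3}`. [folklore] -/
private theorem univ_units_zmod_four : (Finset.univ : Finset (ZMod 4)ˣ) = {1, u3} := by decide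
/-- `(ℤ/8)ˣ = {1, 3, 5, 7}`. [folklore] -/
private theorem univ_units_zmod_eight : (Finset.univ : Finset (ZMod 8)ˣ) = {1, w3, w5, w7} := by decide

/-- **Gauss digit, conductor 4** (`n = 2`): `‖Σ_{a ∈ (ℤ/4)ˣ} f(a)⁻¹ ζ^{−a}‖ = 2⁻¹` for a character `f` with
`f(3) = −1` and `ζ² = −1`, in any normed field with `‖2‖ = 1/2`; the sum is `−2ζ`. The archimedean twin is
`|τ(χ)| = √N`. [cite: deShalit1987, II.4.11 Remark (i) (p. 66)] [cite: Bump1997, Ch. 1 §1 eq. (1.5) (p. 13)] -/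
theorem norm_gaussSum_four (h2 : ‖(2 : F)‖ = 2⁻¹) (ζ : F) (hζ : ζ ^ 2 = -1)
    (f : (ZMod 4)ˣ →* Fˣ) (hf : ((f u3 : Fˣ) : F) = -1) :
    ‖∑ a : (ZMod 4)ˣ, ((f a : Fˣ) : F)⁻¹ * (ζ ^ (a : ZMod 4).val)⁻¹‖ = (2 : ℝ) ^ (-(2 : ℝ) / 2) := by
  have hne : (1 : (ZMod 4)ˣ) ≠ u3 := by decide
  rw [univ_units_zmod_four, Finset.sum_pair hne, map_one, hf]
  have h1 : ((1 : (ZMod 4)ˣ) : ZMod 4).val = 1 := by decide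
  have h3 : ((u3 : (ZMod 4)ˣ) : ZMod 4).val = 3 := by decide
  rw [h1, h3, Units.val_one]
  have hζ3 : ζ ^ 3 = -ζ := by rw [pow_succ, hζ]; ring
  have hζinv : ζ⁻¹ = -ζ := inv_eq_of_mul_eq_one_right (by rw [mul_neg, ← sq, hζ, neg_neg])
  have hsum : (1 : F)⁻¹ * (ζ ^ 1)⁻¹ + (-1 : F)⁻¹ * (ζ ^ 3)⁻¹ = -2 * ζ := by
    rw [pow_one, hζ3, inv_one, one_mul, inv_neg, inv_neg, hζinv]; ring
  rw [hsum, norm_mul, norm_neg, h2, norm_eq_one_of_pow_eq_neg_one two_ne_zero hζ]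
  norm_num

/-- **Gauss digit, conductor 8** (`n = 3`): `‖Σ_{a ∈ (ℤ/8)ˣ} f(a)⁻¹ ζ^{−a}‖ = 2^{−3/2}` for a character
`f` with `f(5) = −1` and `ζ⁴ = −1`, in any normed field with `‖2‖ = 1/2`; the sum is `−2ζ(ζ² + f(3))`,
`f(3) = ±1`, `‖ζ² ± 1‖ = 2^{−1/2}`. [cite: deShalit1987, II.4.11 Remark (i) (p. 66)] [cite: Bump1997, Ch. 1 §1 eq. (1.5) (p. 13)] -/
theorem norm_gaussSum_eight (h2 : ‖(2 : F)‖ = 2⁻¹) (ζ : F) (hζ : ζ ^ 4 = -1)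
    (f : (ZMod 8)ˣ →* Fˣ) (hf : ((f w5 : Fˣ) : F) = -1) :
    ‖∑ a : (ZMod 8)ˣ, ((f a : Fˣ) : F)⁻¹ * (ζ ^ (a : ZMod 8).val)⁻¹‖ = (2 : ℝ) ^ (-(3 : ℝ) / 2) := by
  have h33 : w3 * w3 = 1 := by decide
  have h35 : w3 * w5 = w7 := by decide
  set s : F := ((f w3 : Fˣ) : F) with hs
  have hs2 : s ^ 2 = 1 := by
    rw [sq, hs, ← Units.val_mul, ← map_mul, h33, map_one, Units.val_one]
  have hsinv : s⁻¹ = s := inv_eq_of_mul_eq_one_right (by rw [← sq, hs2])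
  have hf7 : ((f w7 : Fˣ) : F) = -s := by
    rw [← h35, map_mul, Units.val_mul, hf, ← hs]; ring
  rw [univ_units_zmod_eight, Finset.sum_insert (by decide), Finset.sum_insert (by decide),
    Finset.sum_pair (by decide)]
  have hv1 : ((1 : (ZMod 8)ˣ) : ZMod 8).val = 1 := by decide
  have hv3 : ((w3 : (ZMod 8)ˣ) : ZMod 8).val = 3 := by decide
  have hv5 : ((w5 : (ZMod 8)ˣ) : ZMod 8).val = 5 := by decide
  have hv7 : ((w7 : (ZMod 8)ˣ) : ZMod 8).val = 7 := by decide
  rw [hv1, hv3, hv5, hv7, map_one, Units.val_one, hf, hf7, ← hs]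
  have hζinv : ζ⁻¹ = -ζ ^ 3 :=
    inv_eq_of_mul_eq_one_right (by rw [mul_neg, ← pow_succ', hζ, neg_neg])
  have hζ3inv : (ζ ^ 3)⁻¹ = -ζ :=
    inv_eq_of_mul_eq_one_right (by rw [mul_neg, ← pow_succ, hζ, neg_neg])
  have hζ5 : ζ ^ 5 = -ζ := by rw [pow_succ, hζ]; ring
  have hζ7 : ζ ^ 7 = -ζ ^ 3 := by rw [show (7 : ℕ) = 4 + 3 from rfl, pow_add, hζ]; ring
  have hsum : (1 : F)⁻¹ * (ζ ^ 1)⁻¹ + (s⁻¹ * (ζ ^ 3)⁻¹ + ((-1 : F)⁻¹ * (ζ ^ 5)⁻¹ + (-s)⁻¹ * (ζ ^ 7)⁻¹))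
      = -2 * ζ * (ζ ^ 2 + s) := by
    rw [pow_one, hζ5, hζ7]
    simp only [inv_neg, inv_one]
    rw [hζinv, hζ3inv, hsinv]; ring
  have hi : (ζ ^ 2) ^ 2 = -1 := by rw [← pow_mul]; exact hζ
  rw [hsum, norm_mul, norm_mul, norm_neg, h2, norm_eq_one_of_pow_eq_neg_one (by norm_num) hζ,
    norm_sq_root_add_sign h2 hi hs2, mul_one, ← Real.rpow_neg_one,
    ← Real.rpow_add (by norm_num : (0 : ℝ) < 2)]
  norm_num

/-- **The Gauss digit at conductors `2ⁿ`, `n ∈ {2, 3}` — weakest sufficient form (norm only; no phase, no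
orientation, no `γ₀`-coherence).** For a character `f` of `(ℤ/2ⁿ)ˣ` with `f(1 + 2ⁿ⁻¹) = −1` (exact level `n`)
and `ζ^{2^{n−1}} = −1` (a primitive `2ⁿ`-th root of unity), in any normed field with `‖2‖ = 1/2` (e.g. `ℂ₂`):
`‖Σ_a f(a)⁻¹ ζ^{−a}‖ = 2^{−n/2}` — the `2`-adic size `v₂(τ) = n/2` behind `GḠ = p^{n(k−1)}` at `k = 0`.
[cite: deShalit1987, II.4.11 Remark (i) (p. 66)] [cite: Bump1997, Ch. 1 §1 eq. (1.5) (p. 13)] -/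
theorem norm_gaussSum_two_pow (h2 : ‖(2 : F)‖ = 2⁻¹) {n : ℕ} (hn : n = 2 ∨ n = 3) (ζ : F)
    (hζ : ζ ^ 2 ^ (n - 1) = -1) (f : (ZMod (2 ^ n))ˣ →* Fˣ) (γ₀ : (ZMod (2 ^ n))ˣ)
    (hγ₀ : (γ₀ : ZMod (2 ^ n)) = 1 + 2 ^ (n - 1)) (hf : ((f γ₀ : Fˣ) : F) = -1) :
    ‖∑ a : (ZMod (2 ^ n))ˣ, ((f a : Fˣ) : F)⁻¹ * (ζ ^ (a : ZMod (2 ^ n)).val)⁻¹‖ =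
      (2 : ℝ) ^ (-(n : ℝ) / 2) := by
  rcases hn with rfl | rfl
  · have hγ : γ₀ = u3 := Units.ext (by rw [hγ₀]; decide)
    rw [hγ] at hf
    have h := norm_gaussSum_four h2 ζ (by simpa using hζ) f hf
    simpa using h
  · have hγ : γ₀ = w5 := Units.ext (by rw [hγ₀]; decide)
    rw [hγ] at hf
    have h := norm_gaussSum_eight h2 ζ (by simpa using hζ) f hf
    simpa using h


end GaussSumTwoPower

end Literature.NumberTheory.LFunctions

end
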